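import Literature.NumberTheory.Automorphic.HermitianLatticeTreeTransitiveRamified     -- ★ (r1-C hA) `forall_isSelfDualLattice_exists_latt_eq_of_ramified`
import Literature.NumberTheory.Automorphic.HermitianLatticeTreeEulerRelation          -- ★ (T3) A-p17: tree files (Frames ∕ Parent ∕ IsTree)
import Literature.NumberTheory.Automorphic.HermitianLatticeTreeFlagTransitive         -- ★ B-p04 (g35): `forall_flag_exists_latt_eq_of_rootStar`, `exists_eq_latt_mul_diagonal_of_isModularLattice`, `isUnimodular₂_antidiag`
import Literature.NumberTheory.Automorphic.ValuedFieldValuativeRelBridge               -- ★ `v_lt_one_iff_valuation_lt_one`, `v_le_one_iff_valuation_le_one`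
import HarnessLib

/-!
# The transitivity binders of the Euler relation on the lattice tree at a TAMELY RAMIFIED place, II: the two `ϖ`-modular neighbours of the root, (hI) and (hB)
(Jacobowitz 1962, §8; Bruhat–Tits 1972, §10 — at a ramified place the self-dual vertex `L₀ = 𝒪_w²` of the hyperbolic plane `Φ = antidiag(1, 1)` has exactly TWO
`ϖ`-modular neighbours, `𝒪e₁ + ϖ𝒪e₂` and `ϖ𝒪e₁ + 𝒪e₂`, swapped by `Φ ∈ U(Φ) ∩ GL₂(𝒪_w)`; the lattice tree is the barycentric subdivision of the tree of `SU(1,1) ≅ SL₂`)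

Topic `NumberTheory/Automorphic`; namespace `Literature.NumberTheory.Automorphic.HermitianLatticeTree`.  THEOREMS ONLY (no definition, no instance, no notation, no named fact,
no `sorry`).  Cell `pub/hodgecm-mathlib`, F0∕P3a, crux H413 = stmt-HodgeConjecture-24833, line «N6nsGerm», (R2) Euler–Poincaré road, RAMIFIED half (census
`F0/P3a/A-p06/g27/CENSUS-R2ram-RamifiedEulerPoincare.A-p06g27.md` §5 (r1-C); LEAD F0P3a-plan (g10) T9-8 (B); seat A-p06 (g27)); consumers = binders `hI`, `hB` of A-p17 (g22)'s
★ (T3) `natCard_fixedBy_add_eq_natCard_fixedBy_inf_add_one` at a ramified `w` with `H = Φ = !![0, 1; 1, 0]`, `g₁ = diag(1, ϖ)` (B-p04's `hE` instance; my (S8) `hN` assembly).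
HONEST LABEL: HC_CM is proved only modulo the 2 remaining named inputs (hLiu418, h413) until rung 0 closes.

* §1 (any valued field `E`, `σ` valuation-preserving, `ϖ` uniformizing, `𝒪` a DVR; `Φ = !![0, 1; 1, 0]`):
  `isSelfDualLattice_latt_diagonal_antidiag` ∕ `isModularLattice_latt_diagonal_antidiag` (the apartment: `latt diag(ϖ^a, ϖ^{−a})` self-dual, `latt diag(ϖ^a, ϖ^{1−a})` modular);
  `exists_swap_mem_unitaryGroupOfForm_antidiag`, `latt_swap_mul_diagonal_eq` (the swap `Φ ∈ U(Φ) ∩ GL₂(𝒪)`, `latt (Φ·diag(1,ϖ)) = latt diag(ϖ,1)`);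
  **`forall_isModularLattice_rootStar_exists_latt_mul_eq_of_ramifiedInvolution`** — if `σ ≡ id (mod 𝔭)` on `𝒪` and `|2| = 1` (a TAMELY RAMIFIED involution), the star of the
  root has TWO `ϖ`-modular vertices `latt diag(1, ϖ)`, `latt diag(ϖ, 1)`, one `{1, Φ}`-orbit (the ramified `hK` of ★ B-p04 `forall_flag_exists_latt_eq_of_rootStar`);
  **`forall_flag_exists_latt_eq_of_ramifiedInvolution`** = (hI) from (hA); **`forall_isModularLattice_exists_latt_mul_eq_of_flag`** = (hB) from (hI) (+ ★ `latticeParent_spec`).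
* §2 (a tamely ramified non-split place `w ∣ v` of a quadratic extension of number fields, `σ_w = galAdicCompletionMap c hw`): **`forall_flag_exists_latt_eq_of_ramified`** (hI) and
  **`forall_isModularLattice_exists_latt_mul_eq_of_ramified`** (hB) VERBATIM in the (T3) binder shape, from ★ (hA) `forall_isSelfDualLattice_exists_latt_eq_of_ramified` and
  ★ `valued_galAdicCompletionMap_sub_lt_one_of_ramified`.

## References
* [Jacobowitz1962] R. Jacobowitz, *Hermitian forms over local fields*, Amer. J. Math. 84 (1962), §8.
* [BruhatTits1972] F. Bruhat, J. Tits, *Groupes réductifs sur un corps local I*, Publ. IHÉS 41 (1972), §10.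
* [Serre1980Trees] J.-P. Serre, *Trees* (1980), II.1.1.
-/

set_option autoImplicit false

noncomputable section

open NumberField IsDedekindDomain
open scoped Matrix ValuativeRel MatrixGroups
open Matrix ValuativeRel

namespace Literature.NumberTheory.Automorphic.HermitianLatticeTree

open Literature.NumberTheory.Automorphic Literature.NumberTheory.Automorphic.UnitaryGroup

/-! ## §1 The hyperbolic plane `Φ = antidiag(1, 1)` over a valued field with a tamely ramified involution -/

section Generic

variable {E : Type*} [Field E] [ValuativeRel E] (σ : E →+* E)

variable (hσv : ∀ x : E, valuation E (σ x) = valuation E x) {ϖ : E} (hϖ : IsUniformizingElement ϖ)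

include hσv hϖ in
/-- THE APARTMENT, self-dual vertices: `latt diag(ϖ^a, ϖ^{−a})` is self-dual for `Φ`. [cite: BruhatTits1972, §10] [cite: Serre1980Trees, II.1.1] -/
theorem isSelfDualLattice_latt_diagonal_antidiag (a : ℤ) :
    IsSelfDualLattice σ (!![0, 1; 1, 0] : Matrix (Fin 2) (Fin 2) E) (latt (Matrix.diagonal ![ϖ ^ a, ϖ ^ (-a)])) := by
  have h := (isSelfDualLattice_frame_iff σ hσv hϖ (isUnimodular₂_antidiag (E := E)) 1 (one_mem _) a (-a)).2
  rw [Units.val_one, Matrix.one_mul] at h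
  refine h ⟨by omega, fun i j => ?_⟩
  have hG : formCongr σ (1 : GL (Fin 2) E) (!![0, 1; 1, 0] : Matrix (Fin 2) (Fin 2) E) = !![0, 1; 1, 0] := by
    simp [formCongr, Matrix.map_one σ (map_zero σ) (map_one σ)]
  rw [hG]
  fin_cases i <;> fin_cases j <;> simp

include hσv hϖ in
/-- THE APARTMENT, `ϖ`-modular vertices: `latt diag(ϖ^a, ϖ^{1−a})` is `ϖ`-modular for `Φ`. [cite: BruhatTits1972, §10] [cite: Serre1980Trees, II.1.1] -/
theorem isModularLattice_latt_diagonal_antidiag (a : ℤ) :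
    IsModularLattice σ ϖ (!![0, 1; 1, 0] : Matrix (Fin 2) (Fin 2) E) (latt (Matrix.diagonal ![ϖ ^ a, ϖ ^ (1 - a)])) := by
  have h := (isModularLattice_frame_iff σ hσv hϖ (isUnimodular₂_antidiag (E := E)) 1 (one_mem _) a (1 - a)).2
  rw [Units.val_one, Matrix.one_mul] at h
  refine h ⟨by omega, fun i j => ?_⟩
  have hG : formCongr σ (1 : GL (Fin 2) E) (!![0, 1; 1, 0] : Matrix (Fin 2) (Fin 2) E) = !![0, 1; 1, 0] := by
    simp [formCongr, Matrix.map_one σ (map_zero σ) (map_one σ)]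
  rw [hG]
  fin_cases i <;> fin_cases j <;> simp

omit [ValuativeRel E] in
/-- `latt diag(1, ϖ) = latt diag(ϖ^0, ϖ^1)` and `latt diag(ϖ, 1) = latt diag(ϖ^1, ϖ^0)` (bookkeeping). [cite: Serre1980Trees, II.1.1] -/
theorem diagonal_one_uniformizer_eq (ϖ : E) :
    (Matrix.diagonal ![(1 : E), ϖ] = Matrix.diagonal ![ϖ ^ (0 : ℤ), ϖ ^ (1 : ℤ)]) ∧ (Matrix.diagonal ![ϖ, (1 : E)] = Matrix.diagonal ![ϖ ^ (1 : ℤ), ϖ ^ (0 : ℤ)]) := by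
  constructor <;> (congr 1; funext i; fin_cases i <;> simp)

/-- The SWAP `Φ = !![0,1;1,0]` as an element of `GL₂(E)` (it is its own inverse), in `U(σ, Φ) ∩ GL₂(𝒪)`, with `latt Φ = L₀`. [cite: BruhatTits1972, §10] -/
theorem exists_swap_mem_unitaryGroupOfForm_antidiag :
    ∃ S : GL (Fin 2) E, (S : Matrix (Fin 2) (Fin 2) E) = !![0, 1; 1, 0] ∧ S ∈ unitaryGroupOfForm σ (!![0, 1; 1, 0] : Matrix (Fin 2) (Fin 2) E) ∧
      S ∈ glInt 2 E ∧ latt (S : Matrix (Fin 2) (Fin 2) E) = latt (1 : Matrix (Fin 2) (Fin 2) E) := by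
  have hSS : (!![0, 1; 1, 0] : Matrix (Fin 2) (Fin 2) E) * !![0, 1; 1, 0] = 1 := by
    rw [Matrix.mul_fin_two, Matrix.one_fin_two]; norm_num
  refine ⟨⟨!![0, 1; 1, 0], !![0, 1; 1, 0], hSS, hSS⟩, rfl, ?_, ?_, ?_⟩
  · rw [mem_unitaryGroupOfForm_iff]
    have hmap : ((!![0, 1; 1, 0] : Matrix (Fin 2) (Fin 2) E).map σ) = !![0, 1; 1, 0] := by
      ext i j; fin_cases i <;> fin_cases j <;> simp
    change ((!![0, 1; 1, 0] : Matrix (Fin 2) (Fin 2) E).map σ)ᵀ * !![0, 1; 1, 0] * !![0, 1; 1, 0] = !![0, 1; 1, 0]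
    rw [hmap, Matrix.mul_assoc, hSS, Matrix.mul_one]
    ext i j; fin_cases i <;> fin_cases j <;> rfl
  · rw [mem_glInt_iff]
    constructor <;> (intro i j; fin_cases i <;> fin_cases j <;> simp [zero_mem, one_mem])
  · have h := latt_mul_of_mem_glInt (E := E) 1 ⟨!![0, 1; 1, 0], !![0, 1; 1, 0], hSS, hSS⟩
      (by rw [mem_glInt_iff]; constructor <;> (intro i j; fin_cases i <;> fin_cases j <;> simp [zero_mem, one_mem]))
    rwa [one_mul, Units.val_one] at h

include hσv hϖ in
/-- `latt (S · diag(1, ϖ)) = latt diag(ϖ, 1)` for the swap `S` (both are `ϖ`-modular and the columns of `S·diag(1,ϖ)` — `(0,1)`, `(ϖ,0)` — lie in `latt diag(ϖ,1)`).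
[cite: BruhatTits1972, §10] -/
theorem latt_swap_mul_diagonal_eq [IsDiscreteValuationRing 𝒪[E]] {S g₁ : GL (Fin 2) E} (hS : (S : Matrix (Fin 2) (Fin 2) E) = !![0, 1; 1, 0])
    (hSU : S ∈ unitaryGroupOfForm σ (!![0, 1; 1, 0] : Matrix (Fin 2) (Fin 2) E)) (hg₁ : (g₁ : Matrix (Fin 2) (Fin 2) E) = Matrix.diagonal ![(1 : E), ϖ]) :
    latt (((S * g₁ : GL (Fin 2) E)) : Matrix (Fin 2) (Fin 2) E) = latt (Matrix.diagonal ![ϖ, (1 : E)]) := by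
  have hmod₁ : IsModularLattice σ ϖ (!![0, 1; 1, 0] : Matrix (Fin 2) (Fin 2) E) (latt (g₁ : Matrix (Fin 2) (Fin 2) E)) := by
    rw [hg₁, (diagonal_one_uniformizer_eq ϖ).1]
    simpa using isModularLattice_latt_diagonal_antidiag σ hσv hϖ 0
  have hmod₂ : IsModularLattice σ ϖ (!![0, 1; 1, 0] : Matrix (Fin 2) (Fin 2) E) (latt (Matrix.diagonal ![ϖ, (1 : E)])) := by
    rw [(diagonal_one_uniformizer_eq ϖ).2]
    simpa using isModularLattice_latt_diagonal_antidiag σ hσv hϖ 1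
  have hmod : IsModularLattice σ ϖ (!![0, 1; 1, 0] : Matrix (Fin 2) (Fin 2) E) (latt (((S * g₁ : GL (Fin 2) E)) : Matrix (Fin 2) (Fin 2) E)) := by
    have h := isModularLattice_mapGL σ ϖ _ S hSU hmod₁
    rwa [mapGL_latt] at h
  have hd₂ : ∀ i, (![ϖ, (1 : E)] : Fin 2 → E) i ≠ 0 := by
    rw [Fin.forall_fin_two]; exact ⟨hϖ.ne_zero, one_ne_zero⟩
  refine eq_of_le_of_isModularLattice σ hσv hmod hmod₂ (Submodule.span_le.2 (Set.range_subset_iff.2 fun j => (mem_latt_diagonal_iff hd₂ _).2 fun i => ?_))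
  rw [Units.val_mul, hS, hg₁, Matrix.transpose_apply, Matrix.mul_diagonal]
  fin_cases i <;> fin_cases j
  · show ϖ⁻¹ * (0 * 1) ∈ 𝒪[E]
    rw [zero_mul, mul_zero]; exact zero_mem _
  · show ϖ⁻¹ * (1 * ϖ) ∈ 𝒪[E]
    rw [one_mul, inv_mul_cancel₀ hϖ.ne_zero]; exact one_mem _
  · show (1 : E)⁻¹ * (1 * 1) ∈ 𝒪[E]
    rw [inv_one, one_mul, one_mul]; exact one_mem _
  · show (1 : E)⁻¹ * (0 * ϖ) ∈ 𝒪[E]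
    rw [zero_mul, mul_zero]; exact zero_mem _

include hσv hϖ in
/-- **THE STAR OF THE ROOT under a TAMELY RAMIFIED involution has two vertices, swapped by `Φ`**: if `σ ≡ id (mod 𝔭)` on `𝒪` and `|2| = 1` (`𝒪` a DVR, `ϖ`
uniformizing, `↑g₁ = diag(1, ϖ)`), every `ϖ`-modular `N` with `ϖL₀ ≤ N ≤ L₀` is `latt (k·g₁)` for `k ∈ {1, Φ} ⊂ U(Φ) ∩ GL₂(𝒪)` — i.e. `N ∈ {latt diag(1,ϖ), latt diag(ϖ,1)}`.
(★ `exists_eq_latt_mul_diagonal_of_isModularLattice`: `N = 𝒪·Pe₀ + ϖL₀` with `|σ(p)q + σ(q)p| < 1` for `Pe₀ = (p, q)`; ramified: `σ(p)q + σ(q)p ≡ 2pq`, so `p ∈ 𝔭` or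
`q ∈ 𝔭`, which puts `N` inside — hence equal to, ★ `eq_of_le_of_isModularLattice` — `latt diag(ϖ,1)` or `latt diag(1,ϖ)`.)  The ramified twin of ★
`forall_isModularLattice_rootStar_exists_latt_mul_eq` (inert: `q + 1` vertices, one `K`-orbit). [cite: Jacobowitz1962, §8] [cite: BruhatTits1972, §10] -/
theorem forall_isModularLattice_rootStar_exists_latt_mul_eq_of_ramifiedInvolution [IsDiscreteValuationRing 𝒪[E]]
    (hres : ∀ x : E, valuation E x ≤ 1 → valuation E (σ x - x) < 1) (h2 : valuation E (2 : E) = 1)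
    {g₁ : GL (Fin 2) E} (hg₁ : (g₁ : Matrix (Fin 2) (Fin 2) E) = Matrix.diagonal ![(1 : E), ϖ]) :
    ∀ N : Submodule 𝒪[E] (Fin 2 → E), IsModularLattice σ ϖ (!![0, 1; 1, 0] : Matrix (Fin 2) (Fin 2) E) N →
      scaleLattice ϖ (latt (1 : Matrix (Fin 2) (Fin 2) E)) ≤ N → N ≤ latt (1 : Matrix (Fin 2) (Fin 2) E) →
      ∃ k : ↥(unitaryGroupOfForm σ (!![0, 1; 1, 0] : Matrix (Fin 2) (Fin 2) E)), (k : GL (Fin 2) E) ∈ glInt 2 E ∧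
        latt (((k : GL (Fin 2) E) * g₁ : GL (Fin 2) E) : Matrix (Fin 2) (Fin 2) E) = N := by
  intro N hN h₁ h₂
  obtain ⟨P, hP, hNP, h00⟩ := exists_eq_latt_mul_diagonal_of_isModularLattice σ hσv hϖ isUnimodular₂_antidiag hN h₁ h₂
  rw [formCongr_antidiag_apply_zero_zero] at h00
  have hPint := ((mem_glInt_iff P).1 hP).1
  -- the residue computation: `|σ(p) q + σ(q) p| < 1 ⇒ |p| < 1 ∨ |q| < 1` for `p, q ∈ 𝒪`
  have key : ∀ p q : E, valuation E p ≤ 1 → valuation E q ≤ 1 → valuation E (σ p * q + σ q * p) < 1 → valuation E p < 1 ∨ valuation E q < 1 := by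
    intro p q hp hq hlt
    by_contra hcon
    rw [not_or, not_lt, not_lt] at hcon
    have hp1 : valuation E p = 1 := le_antisymm hp hcon.1
    have hq1 : valuation E q = 1 := le_antisymm hq hcon.2
    have hdec : (2 : E) * (p * q) = (σ p * q + σ q * p) - ((σ p - p) * q + (σ q - q) * p) := by ring
    have hsmall : valuation E ((σ p - p) * q + (σ q - q) * p) < 1 := by
      refine Valuation.map_add_lt _ ?_ ?_
      · rw [map_mul, hq1, mul_one]; exact hres p hp
      · rw [map_mul, hp1, mul_one]; exact hres q hq
    have h2pq : valuation E ((2 : E) * (p * q)) < 1 := by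
      rw [hdec]
      exact Valuation.map_sub_lt _ hlt hsmall
    rw [map_mul, map_mul, h2, hp1, hq1, one_mul, one_mul] at h2pq
    exact lt_irrefl _ h2pq
  have hpq := key _ _ ((Valuation.mem_integer_iff _ _).1 (hPint 0 0)) ((Valuation.mem_integer_iff _ _).1 (hPint 1 0)) h00
  -- the two diagonal neighbours are modular
  have hd₁ : ∀ i, (![(1 : E), ϖ] : Fin 2 → E) i ≠ 0 := by
    rw [Fin.forall_fin_two]; exact ⟨one_ne_zero, hϖ.ne_zero⟩
  have hd₂ : ∀ i, (![ϖ, (1 : E)] : Fin 2 → E) i ≠ 0 := by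
    rw [Fin.forall_fin_two]; exact ⟨hϖ.ne_zero, one_ne_zero⟩
  have hmod₁ : IsModularLattice σ ϖ (!![0, 1; 1, 0] : Matrix (Fin 2) (Fin 2) E) (latt (Matrix.diagonal ![(1 : E), ϖ])) := by
    rw [(diagonal_one_uniformizer_eq ϖ).1]
    simpa using isModularLattice_latt_diagonal_antidiag σ hσv hϖ 0
  have hmod₂ : IsModularLattice σ ϖ (!![0, 1; 1, 0] : Matrix (Fin 2) (Fin 2) E) (latt (Matrix.diagonal ![ϖ, (1 : E)])) := by
    rw [(diagonal_one_uniformizer_eq ϖ).2]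
    simpa using isModularLattice_latt_diagonal_antidiag σ hσv hϖ 1
  -- `latt X ≤ latt (diagonal d)` from column membership
  have hle : ∀ (X : Matrix (Fin 2) (Fin 2) E) (d : Fin 2 → E) (hd : ∀ i, d i ≠ 0),
      (∀ i j, (d i)⁻¹ * X i j ∈ 𝒪[E]) → latt X ≤ latt (Matrix.diagonal d) := by
    intro X d hd hX
    refine Submodule.span_le.2 (Set.range_subset_iff.2 fun j => ?_)
    exact (mem_latt_diagonal_iff hd _).2 fun i => hX i j
  -- entry bookkeeping
  have e11 : ∀ x : E, x ∈ 𝒪[E] → (1 : E)⁻¹ * (x * 1) ∈ 𝒪[E] := fun x hx => by rwa [inv_one, one_mul, mul_one]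
  have e1ϖ : ∀ x : E, x ∈ 𝒪[E] → (1 : E)⁻¹ * (x * ϖ) ∈ 𝒪[E] := fun x hx => by rw [inv_one, one_mul]; exact mul_mem hx hϖ.mem
  have eϖ1 : ∀ x : E, x ∈ 𝒪[E] → valuation E x < 1 → ϖ⁻¹ * (x * 1) ∈ 𝒪[E] := fun x hx hlt => by rw [mul_one]; exact hϖ.inv_mul_mem hx hlt
  have eϖϖ : ∀ x : E, x ∈ 𝒪[E] → ϖ⁻¹ * (x * ϖ) ∈ 𝒪[E] := fun x hx => by
    rwa [← mul_assoc, mul_comm ϖ⁻¹ x, mul_assoc, inv_mul_cancel₀ hϖ.ne_zero, mul_one]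
  have hdiag : Matrix.diagonal ![ϖ ^ (0 : ℤ), ϖ ^ (1 : ℤ)] = Matrix.diagonal ![(1 : E), ϖ] := (diagonal_one_uniformizer_eq ϖ).1.symm
  rw [hdiag] at hNP
  rw [hNP] at hN ⊢
  rcases hpq with hp | hq
  · -- `p ∈ 𝔭`: `N = latt diag(ϖ, 1) = latt (Φ g₁)`
    obtain ⟨S, hS, hSU, hSint, -⟩ := exists_swap_mem_unitaryGroupOfForm_antidiag (E := E) σ
    refine ⟨⟨S, hSU⟩, hSint, ?_⟩
    change latt (((S * g₁ : GL (Fin 2) E)) : Matrix (Fin 2) (Fin 2) E) = _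
    rw [latt_swap_mul_diagonal_eq σ hσv hϖ hS hSU hg₁]
    refine (eq_of_le_of_isModularLattice σ hσv hN hmod₂ (hle _ _ hd₂ fun i j => ?_)).symm
    rw [Matrix.mul_diagonal]
    fin_cases i <;> fin_cases j
    · exact eϖ1 _ (hPint 0 0) hp
    · exact eϖϖ _ (hPint 0 1)
    · exact e11 _ (hPint 1 0)
    · exact e1ϖ _ (hPint 1 1)
  · -- `q ∈ 𝔭`: `N = latt diag(1, ϖ) = latt (1 · g₁)`
    refine ⟨1, one_mem _, ?_⟩
    rw [Subgroup.coe_one, one_mul, hg₁]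
    refine (eq_of_le_of_isModularLattice σ hσv hN hmod₁ (hle _ _ hd₁ fun i j => ?_)).symm
    rw [Matrix.mul_diagonal]
    fin_cases i <;> fin_cases j
    · exact e11 _ (hPint 0 0)
    · exact e1ϖ _ (hPint 0 1)
    · exact eϖ1 _ (hPint 1 0) hq
    · exact eϖϖ _ (hPint 1 1)

include hσv hϖ in
/-- **(hI) FROM (hA) under a tamely ramified involution**: if `U(σ, Φ)` is transitive on self-dual lattices then it is transitive on FLAGS (self-dual `M` ⊃ `ϖ`-modular `N` ⊃ `ϖM`),
with `↑g₁ = diag(1, ϖ)` (★ B-p04 `forall_flag_exists_latt_eq_of_rootStar` + the two-vertex root star). [cite: BruhatTits1972, §10] [cite: Jacobowitz1962, §8] -/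
theorem forall_flag_exists_latt_eq_of_ramifiedInvolution [IsDiscreteValuationRing 𝒪[E]]
    (hres : ∀ x : E, valuation E x ≤ 1 → valuation E (σ x - x) < 1) (h2 : valuation E (2 : E) = 1)
    (hA : ∀ M : Submodule 𝒪[E] (Fin 2 → E), IsSelfDualLattice σ (!![0, 1; 1, 0] : Matrix (Fin 2) (Fin 2) E) M →
      ∃ u : ↥(unitaryGroupOfForm σ (!![0, 1; 1, 0] : Matrix (Fin 2) (Fin 2) E)), latt (((u : GL (Fin 2) E)) : Matrix (Fin 2) (Fin 2) E) = M)
    {g₁ : GL (Fin 2) E} (hg₁ : (g₁ : Matrix (Fin 2) (Fin 2) E) = Matrix.diagonal ![(1 : E), ϖ]) :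
    ∀ M N : Submodule 𝒪[E] (Fin 2 → E), IsSelfDualLattice σ (!![0, 1; 1, 0] : Matrix (Fin 2) (Fin 2) E) M →
      IsModularLattice σ ϖ (!![0, 1; 1, 0] : Matrix (Fin 2) (Fin 2) E) N → scaleLattice ϖ M ≤ N → N ≤ M →
      ∃ u : ↥(unitaryGroupOfForm σ (!![0, 1; 1, 0] : Matrix (Fin 2) (Fin 2) E)), latt (((u : GL (Fin 2) E)) : Matrix (Fin 2) (Fin 2) E) = M ∧
        latt (((u : GL (Fin 2) E) * g₁ : GL (Fin 2) E) : Matrix (Fin 2) (Fin 2) E) = N :=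
  forall_flag_exists_latt_eq_of_rootStar σ ϖ _ g₁ hA (forall_isModularLattice_rootStar_exists_latt_mul_eq_of_ramifiedInvolution σ hσv hϖ hres h2 hg₁)

include hσv hϖ in
/-- **(hB) FROM (hI)**: every `ϖ`-modular lattice is `latt (u · g₁)` for some `u ∈ U(σ, Φ)` — apply (hI) to the flag `(latticeParent N, N)` (★ `latticeParent_spec`).
[cite: BruhatTits1972, §10] [cite: Serre1980Trees, II.1.1] -/
theorem forall_isModularLattice_exists_latt_mul_eq_of_flag [IsDiscreteValuationRing 𝒪[E]] {g₁ : GL (Fin 2) E}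
    (hI : ∀ M N : Submodule 𝒪[E] (Fin 2 → E), IsSelfDualLattice σ (!![0, 1; 1, 0] : Matrix (Fin 2) (Fin 2) E) M →
      IsModularLattice σ ϖ (!![0, 1; 1, 0] : Matrix (Fin 2) (Fin 2) E) N → scaleLattice ϖ M ≤ N → N ≤ M →
      ∃ u : ↥(unitaryGroupOfForm σ (!![0, 1; 1, 0] : Matrix (Fin 2) (Fin 2) E)), latt (((u : GL (Fin 2) E)) : Matrix (Fin 2) (Fin 2) E) = M ∧
        latt (((u : GL (Fin 2) E) * g₁ : GL (Fin 2) E) : Matrix (Fin 2) (Fin 2) E) = N) :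
    ∀ M : Submodule 𝒪[E] (Fin 2 → E), IsModularLattice σ ϖ (!![0, 1; 1, 0] : Matrix (Fin 2) (Fin 2) E) M →
      ∃ u : ↥(unitaryGroupOfForm σ (!![0, 1; 1, 0] : Matrix (Fin 2) (Fin 2) E)), latt (((u : GL (Fin 2) E) * g₁ : GL (Fin 2) E) : Matrix (Fin 2) (Fin 2) E) = M := by
  intro N hN
  have hΦ := isUnimodular₂_antidiag (E := E)
  have hN0 : N ≠ latt (1 : Matrix (Fin 2) (Fin 2) E) := by
    rintro rfl
    exact not_isModularLattice_of_isSelfDualLattice σ hσv hϖ _ (isSelfDualLattice_latt_one σ hΦ) hN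
  obtain ⟨hPsd, hP₁, hP₂, -, -⟩ := (latticeParent_spec σ hσv hϖ hΦ (Or.inr hN) hN0).2 hN
  obtain ⟨u, -, hu⟩ := hI _ _ hPsd hN hP₁ hP₂
  exact ⟨u, hu⟩

end Generic

/-! ## §2 At a tamely ramified non-split place `w ∣ v` -/

section Ramified

variable {F E : Type} [Field F] [NumberField F] [Field E] [NumberField E] [Algebra F E]
  [Algebra.IsQuadraticExtension F E] (c : E ≃ₐ[F] E) {v : HeightOneSpectrum (𝓞 F)} (w : UnitaryGroup.PlacesOver E v)

/-- `σ_w ≡ id (mod 𝔭_w)` on `𝒪_w` at a ramified non-split place, in the `ValuativeRel` currency (★ `valued_galAdicCompletionMap_sub_lt_one_of_ramified`).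
[cite: Jacobowitz1962, §8] -/
theorem valuation_galAdicCompletionMap_sub_lt_one_of_ramified (hc1 : c ≠ 1) (hw : c • w.1 = w.1) (he : v.asIdeal.ramificationIdx' w.1.asIdeal ≠ 1)
    (x : w.1.adicCompletion E) (hx : valuation (w.1.adicCompletion E) x ≤ 1) :
    valuation (w.1.adicCompletion E) (galAdicCompletionMap (L := E) c hw x - x) < 1 :=
  (v_lt_one_iff_valuation_lt_one _).1
    (Liu2021.LemD1IndexedNonVacuityRamifiedConverse.valued_galAdicCompletionMap_sub_lt_one_of_ramified E c v hc1 w hw he x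
      ((v_le_one_iff_valuation_le_one x).2 hx))

omit [NumberField F] [Algebra.IsQuadraticExtension F E] in
/-- `|2|_w = 1` from `2 ∈ 𝒪_w^×`. [cite: Jacobowitz1962, §8] -/
theorem valuation_two_eq_one_of_isUnit (h2 : IsUnit (2 : 𝒪[w.1.adicCompletion E])) : valuation (w.1.adicCompletion E) (2 : w.1.adicCompletion E) = 1 := by
  have h := (Valuation.integer.integers (valuation (w.1.adicCompletion E))).isUnit_iff_valuation_eq_one.mp h2
  rwa [map_ofNat] at h

/-- **(hA) AT A TAMELY RAMIFIED PLACE for `Φ = !![0,1;1,0]`** (★ `forall_isSelfDualLattice_exists_latt_eq_of_ramified` at the unimodular hermitian `J = Φ`).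
[cite: Jacobowitz1962, §8] [cite: BruhatTits1972, §10] -/
theorem forall_isSelfDualLattice_exists_latt_eq_of_ramified_antidiag (hc1 : c ≠ 1) (hw : c • w.1 = w.1)
    (he : v.asIdeal.ramificationIdx' w.1.asIdeal ≠ 1) (h2 : IsUnit (2 : 𝒪[w.1.adicCompletion E])) :
    ∀ M : Submodule 𝒪[w.1.adicCompletion E] (Fin 2 → w.1.adicCompletion E),
      IsSelfDualLattice (galAdicCompletionMap (L := E) c hw) (!![0, 1; 1, 0] : Matrix (Fin 2) (Fin 2) (w.1.adicCompletion E)) M →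
      ∃ u : unitaryGroupOfForm (galAdicCompletionMap (L := E) c hw) (!![0, 1; 1, 0] : Matrix (Fin 2) (Fin 2) (w.1.adicCompletion E)),
        latt ((u : GL (Fin 2) (w.1.adicCompletion E)) : Matrix (Fin 2) (Fin 2) (w.1.adicCompletion E)) = M := by
  obtain ⟨S, hS, -, hSint, -⟩ := exists_swap_mem_unitaryGroupOfForm_antidiag (E := w.1.adicCompletion E) (galAdicCompletionMap (L := E) c hw)
  have hSh : ((S : Matrix (Fin 2) (Fin 2) (w.1.adicCompletion E)).map (galAdicCompletionMap (L := E) c hw))ᵀ = S := by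
    rw [hS]; ext i j; fin_cases i <;> fin_cases j <;> simp
  have h := forall_isSelfDualLattice_exists_latt_eq_of_ramified c w hc1 hw he h2 S hSint hSh
  rwa [hS] at h

/-- **(hI) AT A TAMELY RAMIFIED PLACE** — VERBATIM the binder `hI` of ★ (T3) `natCard_fixedBy_add_eq_natCard_fixedBy_inf_add_one` with `H = Φ = !![0,1;1,0]`, `g₁ = diag(1, ϖ)`
(`ϖ` any uniformizing element of `E_w`, `𝒪_w` a DVR). [cite: BruhatTits1972, §10] [cite: Jacobowitz1962, §8] -/
theorem forall_flag_exists_latt_eq_of_ramified (hc1 : c ≠ 1) (hw : c • w.1 = w.1) (he : v.asIdeal.ramificationIdx' w.1.asIdeal ≠ 1)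
    (h2 : IsUnit (2 : 𝒪[w.1.adicCompletion E])) [IsDiscreteValuationRing 𝒪[w.1.adicCompletion E]] {ϖ : w.1.adicCompletion E} (hϖ : IsUniformizingElement ϖ)
    {g₁ : GL (Fin 2) (w.1.adicCompletion E)} (hg₁ : (g₁ : Matrix (Fin 2) (Fin 2) (w.1.adicCompletion E)) = Matrix.diagonal ![(1 : w.1.adicCompletion E), ϖ]) :
    ∀ M N : Submodule 𝒪[w.1.adicCompletion E] (Fin 2 → w.1.adicCompletion E),
      IsSelfDualLattice (galAdicCompletionMap (L := E) c hw) (!![0, 1; 1, 0] : Matrix (Fin 2) (Fin 2) (w.1.adicCompletion E)) M →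
      IsModularLattice (galAdicCompletionMap (L := E) c hw) ϖ (!![0, 1; 1, 0] : Matrix (Fin 2) (Fin 2) (w.1.adicCompletion E)) N →
      scaleLattice ϖ M ≤ N → N ≤ M →
      ∃ u : unitaryGroupOfForm (galAdicCompletionMap (L := E) c hw) (!![0, 1; 1, 0] : Matrix (Fin 2) (Fin 2) (w.1.adicCompletion E)),
        latt ((u : GL (Fin 2) (w.1.adicCompletion E)) : Matrix (Fin 2) (Fin 2) (w.1.adicCompletion E)) = M ∧
        latt (((u : GL (Fin 2) (w.1.adicCompletion E)) * g₁ : GL (Fin 2) (w.1.adicCompletion E)) : Matrix (Fin 2) (Fin 2) (w.1.adicCompletion E)) = N :=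
  forall_flag_exists_latt_eq_of_ramifiedInvolution (galAdicCompletionMap (L := E) c hw) (fun x => valuation_galAdicCompletionMap_eq c v w hw x) hϖ
    (valuation_galAdicCompletionMap_sub_lt_one_of_ramified c w hc1 hw he) (valuation_two_eq_one_of_isUnit w h2)
    (forall_isSelfDualLattice_exists_latt_eq_of_ramified_antidiag c w hc1 hw he h2) hg₁

/-- **(hB) AT A TAMELY RAMIFIED PLACE** — VERBATIM the binder `hB` of ★ (T3) with `H = Φ`, `g₁ = diag(1, ϖ)`: `U(Φ)(E_w)` is transitive on `ϖ`-modular lattices («one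
vertex orbit» of the ramified tree). [cite: BruhatTits1972, §10] [cite: Jacobowitz1962, §8] -/
theorem forall_isModularLattice_exists_latt_mul_eq_of_ramified (hc1 : c ≠ 1) (hw : c • w.1 = w.1) (he : v.asIdeal.ramificationIdx' w.1.asIdeal ≠ 1)
    (h2 : IsUnit (2 : 𝒪[w.1.adicCompletion E])) [IsDiscreteValuationRing 𝒪[w.1.adicCompletion E]] {ϖ : w.1.adicCompletion E} (hϖ : IsUniformizingElement ϖ)
    {g₁ : GL (Fin 2) (w.1.adicCompletion E)} (hg₁ : (g₁ : Matrix (Fin 2) (Fin 2) (w.1.adicCompletion E)) = Matrix.diagonal ![(1 : w.1.adicCompletion E), ϖ]) :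
    ∀ M : Submodule 𝒪[w.1.adicCompletion E] (Fin 2 → w.1.adicCompletion E),
      IsModularLattice (galAdicCompletionMap (L := E) c hw) ϖ (!![0, 1; 1, 0] : Matrix (Fin 2) (Fin 2) (w.1.adicCompletion E)) M →
      ∃ u : unitaryGroupOfForm (galAdicCompletionMap (L := E) c hw) (!![0, 1; 1, 0] : Matrix (Fin 2) (Fin 2) (w.1.adicCompletion E)),
        latt (((u : GL (Fin 2) (w.1.adicCompletion E)) * g₁ : GL (Fin 2) (w.1.adicCompletion E)) : Matrix (Fin 2) (Fin 2) (w.1.adicCompletion E)) = M :=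
  forall_isModularLattice_exists_latt_mul_eq_of_flag (galAdicCompletionMap (L := E) c hw) (fun x => valuation_galAdicCompletionMap_eq c v w hw x) hϖ
    (forall_flag_exists_latt_eq_of_ramified c w hc1 hw he h2 hϖ hg₁)

end Ramified


end Literature.NumberTheory.Automorphic.HermitianLatticeTree

end
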